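import Mathlib
import Literature.Analysis.FluidPDE.Tao2016AveragedNS.ShiftSetCascadeFlows
import Summits.NavierStokesRegularity.NavierStokesRegularity.Theorems.TaoLadderRungTwoFlatCertificateGlueCheckerAssembleOn
import HarnessLib

/-!
# Certificate glue on a shift set `𝕊`, XXVIII: THE CHAIN CHECKER — a list of Lohner-step records with DEFINITIONAL nodes and hulls;
  every step that passes `stepCert_of_checks`' tests and hands its landing data to the next record is a `StepCert` of the mesh
  (helper for items stmt-NavierStokesRegularity-22987 `FlatGapCertificatesV2` (crux K_A♭ of route TaoLadderRungTwoFlat) and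
  stmt-24295 K_A₂(64); cell harvest/h2-tao-ladder, p1 g15; CHECKER-SPEC-v3 §3 (iii)–(iv))

`StepRec` = the dyadic/rational data of one step (start parallelepiped `x, C, r, E₀`, landing `x', Cn, Cin, r', E₁`, bounds
`mC, ρC, dP, NVh, κI`, step `h`, allowance `A`); a chain is `rec : ℕ → StepRec`. The node family is DEFINED from the start data,
`nodeOf rec j := PInPara (x j) (C j) (r j) (E₀ j)`, the hull family as the time-resolved tube of step `j` fattened by `A j`
(`hullOf`), so the inclusions `hN` / `hH` of glue XXVII hold by `rfl`; the hand-over `hN'` holds when record `j+1` STARTS where record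
`j` LANDS (`x (j+1) = x' j`, `C (j+1) = Cn j`, `r (j+1) = r' j`, `E₀ (j+1) = E₁ j + A j` — `handsOver`, decidable on the data).
`stepCert_of_rec`: tests of step `j` ∧ hand-over ⇒ `StepCert … (nodeOf rec) (hullOf …) j` on the mesh `t` with `t (j+1) − t j = h j`.
Feeding glue XXII (`htrap/hland_of_branchMeshes`) then needs only: the branch box inside `nodeOf rec 0` (`pinPara_one_of_box`), every
hull inside the open `M`-box (transit) or satisfying the readout clauses (readout steps) — finite checks on `(R_h + A)·ω < M` resp. on the
certified parallelepipeds (successor).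

HONEST FRAMING: Tao-type MODEL lattices (Tao 2016 §4/§6 vocabulary, shift-set parametrised); soundness of a checker — NO certificate
instance exists in the tree, nothing is certified here, no stub is closed, nothing here is a statement about the Navier–Stokes equations.
-/

-- the sub-problem namespace repeats the summit name by design (D-0017)
set_option linter.dupNamespace false

namespace Summit.NavierStokesRegularity.NavierStokesRegularity.Theorems

open Set Finset Literature.Analysis.FluidPDE Literature.Analysis.FluidPDE.TaoCascade
open Summit.NavierStokesRegularity.NavierStokesRegularity.Theorems.TaylorModelCert
open Summit.NavierStokesRegularity.NavierStokesRegularity.Theorems.TaylorModelReadout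

namespace CertificateGlueOn

/-- **ONE LOHNER-STEP RECORD** (dyadic vectors / matrices, dyadic and rational scalars). [cite: Zgliczynski2002C1Lohner, §3–4 (Lohner-type parallelepiped frames); cell certificate format, step record] -/
structure StepRec where
  /-- start centre (weighted coordinates) -/
  x : Array Dyad
  /-- start frame -/
  C : Array (Array Dyad)
  /-- start frame radii -/
  r : Array Dyad
  /-- start remainder radius -/
  E₀ : ℚ
  /-- landing centre -/
  x' : Array Dyad
  /-- landing frame -/
  Cn : Array (Array Dyad)
  /-- approximate inverse of the landing frame -/
  Cin : Array (Array Dyad)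
  /-- landing frame radii -/
  r' : Array Dyad
  /-- landing remainder radius (before the input allowance) -/
  E₁ : ℚ
  /-- centre bound -/
  mC : Dyad
  /-- frame-part bound -/
  ρC : Dyad
  /-- centre defect -/
  dP : Dyad
  /-- variational bound -/
  NVh : Dyad
  /-- approximate-inverse defect -/
  κI : Dyad
  /-- step length -/
  h : ℚ
  /-- input (Grönwall) allowance of the step -/
  A : ℚ
  /-- bootstrap margin `A' > A` -/
  A' : ℚ

variable {m : ℕ} {Kb Ka : ℤ}

/-- The node family DEFINED by the start data of the records. [folklore] -/
def nodeOf (Kb Ka : ℤ) (ωq : Fin m → ℤ → ℚ) (rec : ℕ → StepRec) (j : ℕ) (y : Fin m → ℤ → ℝ) : Prop :=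
  PInPara Kb Ka (fun i k => (ωq i k : ℝ)) (dvec (n := m * winLen Kb Ka) (rec j).x) (dmat (n := m * winLen Kb Ka) (rec j).C)
    (dvec (n := m * winLen Kb Ka) (rec j).r) ((rec j).E₀ : ℝ) y

/-- The hull family DEFINED as the time-resolved tube of step `j` fattened by `A j`. [folklore] -/
def hullOf (Kb Ka : ℤ) (shifts : List (ℤ × ℤ × ℤ)) (q : ℚ) (αq : Fin m → Fin m → Fin m → ℤ × ℤ × ℤ → ℚ) (ωq : Fin m → ℤ → ℚ)
    (p : ℕ) (b : Dyad) (rec : ℕ → StepRec) (j : ℕ) (y : Fin m → ℤ → ℝ) : Prop :=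
  ∃ u ∈ Icc (0 : ℝ) ((rec j).h : ℝ), ∃ q' : Fin m → ℤ → ℝ,
    TubeL shifts.toFinset (q : ℝ) (fun i₁ i₂ i μ => (αq i₁ i₂ i μ : ℝ)) Kb Ka (fun i k => (ωq i k : ℝ)) p b.toReal
      (rec j).mC.toReal (rec j).ρC.toReal ((rec j).E₀ : ℝ)
      (((rec j).mC.toReal + ((rec j).ρC.toReal + ((rec j).E₀ : ℝ))) /
        (1 - b.toReal * ((rec j).mC.toReal + ((rec j).ρC.toReal + ((rec j).E₀ : ℝ))) * ((rec j).h : ℝ)))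
      (dvec (n := m * winLen Kb Ka) (rec j).x) (dmat (n := m * winLen Kb Ka) (rec j).C) (dvec (n := m * winLen Kb Ka) (rec j).r)
      u q' ∧
    ∀ i k, -Kb ≤ k → k ≤ Ka → |y i k - q' i k| ≤ ((rec j).A : ℝ) * (ωq i k : ℝ)

/-- **Hand-over**: record `j+1` starts where record `j` lands (with the allowance absorbed). [folklore] -/
def handsOver (s s' : StepRec) : Prop := s'.x = s.x' ∧ s'.C = s.Cn ∧ s'.r = s.r' ∧ s'.E₀ = s.E₁ + s.A

/-- **`StepCert j` OF THE DEFINITIONAL MESH FROM THE TESTS OF RECORD `j` AND THE HAND-OVER TO RECORD `j+1`.**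
[cite: Zgliczynski2002C1Lohner, §3–4 (Lohner-type parallelepiped frames and the C¹/variational enclosure); cell certificate format, chain checker] -/
theorem stepCert_of_rec (hKb : 0 ≤ Kb) (hKa : 1 ≤ Ka) {shifts : List (ℤ × ℤ × ℤ)} (hnd : shifts.Nodup)
    (h𝕊 : IsNearestNeighbourSet shifts.toFinset) {q : ℚ} (hq : 0 < 1 + (q : ℝ))
    {αq : Fin m → Fin m → Fin m → ℤ × ℤ × ℤ → ℚ} {ωq : Fin m → ℤ → ℚ} (hω : ∀ i k, 0 < ωq i k)
    {prec p kexp nexp : ℕ} {Sp Sm : IntervalD} (hSp : sqrtCheck prec (1 + q) Sp = true)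
    (hSm : sqrtCheck prec (1 / (1 + q)) Sm = true) {M : ℤ → ℝ} {t : ℕ → ℝ} {rec : ℕ → StepRec} {j : ℕ}
    {bD δD : Dyad} {R Eb Et : ℚ}
    (hb : 0 ≤ bD.toReal) (hmC : 0 ≤ (rec j).mC.toReal) (hρC : 0 ≤ (rec j).ρC.toReal) (hE₀ : (0 : ℚ) ≤ (rec j).E₀)
    (hδ : 0 ≤ δD.toReal) (hAA' : (rec j).A < (rec j).A') (hR0 : (0 : ℚ) ≤ R) (ht : t (j + 1) - t j = ((rec j).h : ℝ))
    (hnext : handsOver (rec j) (rec (j + 1)))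
    (hchkB : checkB m Kb Ka shifts (coefBoxOf prec αq ωq Sp Sm) bD = true)
    (h2 : checkAbsLe (m * winLen Kb Ka) (rec j).x (rec j).mC = true)
    (h3 : checkRowSum (m * winLen Kb Ka) (rec j).C (rec j).r (rec j).ρC = true)
    (h4 : checkTPoly (m * winLen Kb Ka) prec
      (IntervalD.polyLevelsA (m * winLen Kb Ka) prec
        (IntervalD.jetLevelsA (m * winLen Kb Ka) (pqBoxA Kb Ka prec shifts (coefBoxOf prec αq ωq Sp Sm)) prec
          (pointBoxA (m * winLen Kb Ka) (rec j).x) p) p (ofRatRel prec (rec j).h)) (rec j).x' (rec j).dP = true)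
    (h5 : checkNVh (m * winLen Kb Ka)
      (IntervalD.polyLevelsA (m * winLen Kb Ka) prec
        (IntervalD.varJetLevelsA (m * winLen Kb Ka) (pqBoxA Kb Ka prec shifts (coefBoxOf prec αq ωq Sp Sm)) prec
          (IntervalD.jetLevelsA (m * winLen Kb Ka) (pqBoxA Kb Ka prec shifts (coefBoxOf prec αq ωq Sp Sm)) prec
            (pointBoxA (m * winLen Kb Ka) (rec j).x) p)
          (unitBoxA (m * winLen Kb Ka)) p) p (ofRatRel prec (rec j).h)) (rec j).NVh = true)
    (h6 : checkFrame (m * winLen Kb Ka)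
      (pcolsA prec (m * winLen Kb Ka) (rec j).Cin (vcolsA Kb Ka prec shifts (coefBoxOf prec αq ωq Sp Sm) p
        (IntervalD.jetLevelsA (m * winLen Kb Ka) (pqBoxA Kb Ka prec shifts (coefBoxOf prec αq ωq Sp Sm)) prec
          (pointBoxA (m * winLen Kb Ka) (rec j).x) p) (ofRatRel prec (rec j).h) (rec j).C)) (rec j).r (rec j).r' = true)
    (h7 : checkKappa prec (m * winLen Kb Ka) (rec j).Cn
      (pcolsA prec (m * winLen Kb Ka) (rec j).Cin (vcolsA Kb Ka prec shifts (coefBoxOf prec αq ωq Sp Sm) p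
        (IntervalD.jetLevelsA (m * winLen Kb Ka) (pqBoxA Kb Ka prec shifts (coefBoxOf prec αq ωq Sp Sm)) prec
          (pointBoxA (m * winLen Kb Ka) (rec j).x) p) (ofRatRel prec (rec j).h) (rec j).C))
      (vcolsA Kb Ka prec shifts (coefBoxOf prec αq ωq Sp Sm) p
        (IntervalD.jetLevelsA (m * winLen Kb Ka) (pqBoxA Kb Ka prec shifts (coefBoxOf prec αq ωq Sp Sm)) prec
          (pointBoxA (m * winLen Kb Ka) (rec j).x) p) (ofRatRel prec (rec j).h) (rec j).C) (rec j).r (rec j).κI = true)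
    (h8 : checkERec p (dyadToRat bD) (dyadToRat (rec j).mC) (dyadToRat (rec j).ρC) (rec j).E₀ (dyadToRat (rec j).κI)
      (dyadToRat (rec j).dP) (dyadToRat (rec j).NVh) (rec j).h (rec j).E₁ = true)
    (h9 : checkGuard (dyadToRat bD) (dyadToRat (rec j).mC) (dyadToRat (rec j).ρC) (rec j).E₀ (rec j).h = true)
    (h9' : checkRegion (dyadToRat bD) (dyadToRat (rec j).mC) (dyadToRat (rec j).ρC) (rec j).E₀ (rec j).h (rec j).A' R = true)
    (h10 : checkDefect m Kb Ka prec shifts αq ωq R Eb Et Sp Sm δD = true)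
    (h11 : checkGronwall (dyadToRat bD) R (dyadToRat δD) (rec j).h (rec j).A kexp nexp = true) :
    StepCert shifts.toFinset (q : ℝ) (fun i₁ i₂ i μ => (αq i₁ i₂ i μ : ℝ)) Kb Ka (Eb : ℝ) (Et : ℝ) M t
      (nodeOf Kb Ka ωq rec) (hullOf Kb Ka shifts q αq ωq p bD rec) j := by
  refine stepCert_of_checks hKb hKa hnd h𝕊 hq hω hSp hSm hb hmC hρC hE₀ hδ hAA' hR0 ht hchkB h2 h3 h4 h5 h6 h7 h8 h9 h9'
    h10 h11 (fun y hy => hy) (fun u hu y q' hq' hnear => ⟨u, hu, q', hq', hnear⟩) (fun y hy => ?_)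
  -- hand-over: the landing parallelepiped of record `j` is the start node of record `j+1`
  obtain ⟨hx, hC, hr, hE⟩ := hnext
  show PInPara Kb Ka (fun i k => (ωq i k : ℝ)) (dvec (rec (j + 1)).x) (dmat (rec (j + 1)).C) (dvec (rec (j + 1)).r)
    ((rec (j + 1)).E₀ : ℝ) y
  rw [hx, hC, hr, hE]
  push_cast
  exact hy

end CertificateGlueOn

end Summit.NavierStokesRegularity.NavierStokesRegularity.Theorems
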